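import Literature.MathematicalPhysics.QuantumFieldTheory.Balaban1983to89.B8Prop5GaugeParamTraceFree
import Literature.MathematicalPhysics.QuantumFieldTheory.Balaban1983to89.B8Prop5ContractionKLevelPer

/-!
# `Balaban1983to89.B8Prop5GaugeParamKLevelPer` — [Balaban1985RegularSpaces] Prop. 5 (1.107)–(1.108) p. 94: the gauge parameter `λ′ = λ + H_cλ`
# at `k` levels ON THE `P`-PERIODIC CONFIGURATIONS, Hermitian and `τ`-free (sub-row «G-B8-T2S», RULING #4 v3, layer 3(c) of
# `lit-balaban-t2s-1/g2/V3-DESIGN.md`)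

statement-level skeleton of published theorems with citation tags; proofs where landed; nothing here is a claim about the
Yang–Mills mass gap

T. Bałaban, *Spaces of regular gauge field configurations on a lattice and gauge fixing conditions*, Commun. Math. Phys. **99** (1985) 75–102
`[Balaban1985RegularSpaces]` ("B8"): Prop. 5 (1.107)–(1.108) p. 94, (1.100)–(1.103) p. 93, (1.104)–(1.106) p. 94, (1.113)–(1.120) pp. 95–96, (1.17) p. 78.
STATUS: published, refereed.

CITATION HEADER (lean-in-tree rule).  Cell `lit-balaban`, seat `lit-balaban-t2s-1` (gen 2).  WHAT IS PROVED.  `gpar_size_at`, `gpar_grad_at`,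
`gpar_lip_at` (`B8Prop5GaugeParamKLevel.gpar_size ∕ gpar_grad ∕ gpar_lip` with the `H_c`-sizes read at the one ∕ two configurations); ★
`gaugeParam_kLevel_per`, ★ `gaugeParam_kLevel_traceFree_per` — `B8Prop5GaugeParamKLevel.gaugeParam_kLevel` and
`B8Prop5GaugeParamTraceFree.gaugeParam_kLevel_traceFree` VERBATIM except: every hypothesis on the Sect. E correction `H_c` (`hc0`–`hc2`, `hcL0`–`hcL2`,
`hcsa`, `hcsupp`, `hcτ`) is assumed at `P`-PERIODIC `λ_s`, `λ_t` only (RULING #4: on the torus `H_c` comes from `D′(u₁⁻¹, −iλ)`, stated at periodic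
`λ`), `H_c` and `G′` are periodic-valued there (`hcper`, `hGper`); the fixed point is `B8Prop5ContractionKLevelPer`'s; ADDED conclusions: `λ_s` and
`λ_{s′}` are `P`-periodic.

HONEST SCOPE.  Verbatim re-threads; [4], (1.99), Sect. E NOT proved (displayed hypotheses); count-neutral; N05 ∕ `stub_PV3A` NOT discharged; nothing
continuum ∕ ℝ⁴ ∕ OS ∕ mass-gap ∕ Clay — the Yang–Mills mass gap is NOT proved.  No `sorry`, no `def`, no `… : Prop` fact, no `instance`, no `notation`.
-/

noncomputable section

open NormedSpace Metric Set Filter Topology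
open Complex (I)

namespace Literature.MathematicalPhysics.QuantumFieldTheory.Balaban1983to89.B8Prop5GaugeParamKLevelPer

open MatrixLog (mlog)
open B7Prop1Explicit (e U1)
open B7Prop2Explicit (unitaryUnits mem_unitaryUnits unitaryUnits_le_U1)
open B7Eq78Linearization (conjR)
open B8Ineq132 (covDerivFwd covDeriv norm_conjR)
open B8Eq138LandauZd (covLap covDivB)
open B8LambdaSpaceKLevel (wt wt_pos wt_nonneg lamSubK lamOf lamOf_sub norm_lamOf_le weight_mul_norm_covDerivFwd_le mkLam lamOf_mkLam
  norm_mkLam_le norm_le_iff norm_sub_le_iff covDerivFwd_add' covDerivFwd_sub')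
open B8Prop5ContractionKLevel (Bd2 Zsol Vop Wsrc PsiP5 Mc Kc mWc KWc covDeriv_sub')
open B8Prop5ContractionKLevelPer (propFive_fixedPoint_kLevel_per propFive_fixedPoint_kLevel_spec_per propFive_fixedPoint_kLevel_selfAdjoint_per
  propFive_fixedPoint_kLevel_traceFree_per)
open B8Prop5GaugeParamKLevel (norm_covDeriv_eq isSelfAdjoint_covLap)
open B8Prop5GaugeParamTraceFree (apply_covLap)

-- `Site` alone could resolve to the torus sites of `Setup.lean`; re-export the `ℤ^d` sites of `B7Prop1Explicit`.
export B7Prop1Explicit (Site)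

variable {d : ℕ} {𝔸 : Type*} [CStarAlgebra 𝔸] [Nontrivial 𝔸]

/-! ## §1 Sizes and moduli of `λ′ = λ + H_cλ` read at one ∕ two configurations -/

section Instantiate

variable {L k : ℕ} {η : ℝ} {Ω : ℕ → Set (Site d)} {Eb : ℕ → Set (Site d × Fin d)} {U₀ : Site d → Fin d → 𝔸ˣ}

omit [Nontrivial 𝔸] in
/-- **(hg0) at one `s`**: `‖λ′_s(x)‖ ≤ ¼α₄ + h₀` from `‖s‖ ≤ ¼α₄` and `‖H_cλ_s‖ ≤ h₀`. [cite: Balaban1985RegularSpaces, (1.120) p.96, (1.108) p.94] -/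
theorem gpar_size_at {Hc : (Site d → 𝔸) → (Site d → 𝔸)} {α₄ h₀ : ℝ} (s : lamSubK η U₀ L k Eb) (hs : ‖s‖ ≤ α₄ / 4)
    (hc0 : ∀ x, ‖Hc (lamOf s) x‖ ≤ h₀) (x : Site d) : ‖(lamOf s + Hc (lamOf s)) x‖ ≤ α₄ / 4 + h₀ := by
  rw [Pi.add_apply]
  exact (norm_add_le _ _).trans (add_le_add ((norm_lamOf_le s x).trans hs) (hc0 x))

/-- **(hg1) at one `s`**: `(Lʲη)‖D_μλ′_s‖, (Lʲη)‖D*_μλ′_s‖ ≤ ¼α₄ + h₁` at the sites of `Ω_j`. [cite: Balaban1985RegularSpaces, (1.120) p.96, (1.108) p.94] -/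
theorem gpar_grad_at (hη : 0 < η) (hU₀ : ∀ x κ, U₀ x κ ∈ unitaryUnits 𝔸)
    (hEbΩ : ∀ j, j ≤ k → ∀ x ∈ Ω j, ∀ μ : Fin d, (x, μ) ∈ Eb j ∧ (x - e μ, μ) ∈ Eb j)
    {Hc : (Site d → 𝔸) → (Site d → 𝔸)} {α₄ h₁ : ℝ} (s : lamSubK η U₀ L k Eb) (hs : ‖s‖ ≤ α₄ / 4)
    (hc1 : ∀ j, j ≤ k → ∀ p ∈ Eb j, wt L η j * ‖covDerivFwd η U₀ p.2 (Hc (lamOf s)) p.1‖ ≤ h₁)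
    {j : ℕ} (hj : j ≤ k) {x : Site d} (hx : x ∈ Ω j) (μ : Fin d) :
    wt L η j * ‖covDerivFwd η U₀ μ (lamOf s + Hc (lamOf s)) x‖ ≤ α₄ / 4 + h₁ ∧
      wt L η j * ‖covDeriv η U₀ μ (lamOf s + Hc (lamOf s)) x‖ ≤ α₄ / 4 + h₁ := by
  have hw : 0 ≤ wt L η j := wt_nonneg L hη.le j
  have key : ∀ y : Site d, (y, μ) ∈ Eb j → wt L η j * ‖covDerivFwd η U₀ μ (lamOf s + Hc (lamOf s)) y‖ ≤ α₄ / 4 + h₁ := by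
    intro y hy
    rw [covDerivFwd_add']
    calc wt L η j * ‖covDerivFwd η U₀ μ (lamOf s) y + covDerivFwd η U₀ μ (Hc (lamOf s)) y‖
        ≤ wt L η j * (‖covDerivFwd η U₀ μ (lamOf s) y‖ + ‖covDerivFwd η U₀ μ (Hc (lamOf s)) y‖) := mul_le_mul_of_nonneg_left (norm_add_le _ _) hw
      _ ≤ α₄ / 4 + h₁ := by
          rw [mul_add]
          exact add_le_add ((weight_mul_norm_covDerivFwd_le hη.le s hj hy).trans hs) (hc1 j hj (y, μ) hy)
  refine ⟨key x (hEbΩ j hj x hx μ).1, ?_⟩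
  rw [norm_covDeriv_eq hU₀]
  exact key (x - e μ) (hEbΩ j hj x hx μ).2

/-- **(hgL) at one pair `s, t`**: `‖λ′_s(x) − λ′_t(x)‖ ≤ (1 + l₀)‖s − t‖`, `(Lʲη)‖D_μ(λ′_s − λ′_t)‖, `(Lʲη)‖D*_μ(λ′_s − λ′_t)‖ ≤ (1 + l₁)‖s − t‖`.
[cite: Balaban1985RegularSpaces, (1.104)–(1.106) p.94] -/
theorem gpar_lip_at (hη : 0 < η) (hU₀ : ∀ x κ, U₀ x κ ∈ unitaryUnits 𝔸)
    (hEbΩ : ∀ j, j ≤ k → ∀ x ∈ Ω j, ∀ μ : Fin d, (x, μ) ∈ Eb j ∧ (x - e μ, μ) ∈ Eb j)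
    {Hc : (Site d → 𝔸) → (Site d → 𝔸)} {l₀ l₁ : ℝ} (s t : lamSubK η U₀ L k Eb)
    (hcL0 : ∀ x, ‖Hc (lamOf s) x - Hc (lamOf t) x‖ ≤ l₀ * ‖s - t‖)
    (hcL1 : ∀ j, j ≤ k → ∀ p ∈ Eb j, wt L η j * ‖covDerivFwd η U₀ p.2 (Hc (lamOf s) - Hc (lamOf t)) p.1‖ ≤ l₁ * ‖s - t‖)
    {j : ℕ} (hj : j ≤ k) {x : Site d} (hx : x ∈ Ω j) :
    ‖(lamOf s + Hc (lamOf s)) x - (lamOf t + Hc (lamOf t)) x‖ ≤ (1 + l₀) * ‖s - t‖ ∧ ∀ μ : Fin d,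
      wt L η j * ‖covDerivFwd η U₀ μ ((lamOf s + Hc (lamOf s)) - (lamOf t + Hc (lamOf t))) x‖ ≤ (1 + l₁) * ‖s - t‖ ∧
      wt L η j * ‖covDeriv η U₀ μ ((lamOf s + Hc (lamOf s)) - (lamOf t + Hc (lamOf t))) x‖ ≤ (1 + l₁) * ‖s - t‖ := by
  have hw : 0 ≤ wt L η j := wt_nonneg L hη.le j
  have hδ := (norm_sub_le_iff hη.le s t (norm_nonneg (s - t))).1 le_rfl
  have hfun : (lamOf s + Hc (lamOf s)) - (lamOf t + Hc (lamOf t)) = (lamOf s - lamOf t) + (Hc (lamOf s) - Hc (lamOf t)) := by abel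
  refine ⟨?_, fun μ => ?_⟩
  · rw [Pi.add_apply, Pi.add_apply]
    calc ‖lamOf s x + Hc (lamOf s) x - (lamOf t x + Hc (lamOf t) x)‖
        = ‖(lamOf s x - lamOf t x) + (Hc (lamOf s) x - Hc (lamOf t) x)‖ := by congr 1; abel
      _ ≤ ‖lamOf s x - lamOf t x‖ + ‖Hc (lamOf s) x - Hc (lamOf t) x‖ := norm_add_le _ _
      _ ≤ ‖s - t‖ + l₀ * ‖s - t‖ := add_le_add (hδ.1 x) (hcL0 x)
      _ = (1 + l₀) * ‖s - t‖ := by ring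
  · have key : ∀ y : Site d, (y, μ) ∈ Eb j →
        wt L η j * ‖covDerivFwd η U₀ μ ((lamOf s + Hc (lamOf s)) - (lamOf t + Hc (lamOf t))) y‖ ≤ (1 + l₁) * ‖s - t‖ := by
      intro y hy
      rw [hfun, covDerivFwd_add']
      calc wt L η j * ‖covDerivFwd η U₀ μ (lamOf s - lamOf t) y + covDerivFwd η U₀ μ (Hc (lamOf s) - Hc (lamOf t)) y‖
          ≤ wt L η j * (‖covDerivFwd η U₀ μ (lamOf s - lamOf t) y‖ + ‖covDerivFwd η U₀ μ (Hc (lamOf s) - Hc (lamOf t)) y‖) :=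
            mul_le_mul_of_nonneg_left (norm_add_le _ _) hw
        _ ≤ ‖s - t‖ + l₁ * ‖s - t‖ := by
            rw [mul_add]; exact add_le_add (hδ.2 j hj (y, μ) hy) (hcL1 j hj (y, μ) hy)
        _ = (1 + l₁) * ‖s - t‖ := by ring
    refine ⟨key x (hEbΩ j hj x hx μ).1, ?_⟩
    rw [norm_covDeriv_eq hU₀]
    exact key (x - e μ) (hEbΩ j hj x hx μ).2

end Instantiate

/-! ## §2 The gauge parameter on the periodic configurations -/

section GaugeParam

variable (τ : 𝔸 →L[ℂ] ℂ)
variable {L k : ℕ} {η : ℝ} {Ω : ℕ → Set (Site d)} {Eb : ℕ → Set (Site d × Fin d)} {U₀ : Site d → Fin d → 𝔸ˣ}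
  {A : Site d → Fin d → 𝔸} {DA : Site d → 𝔸}

/-- ★ **THE GAUGE PARAMETER OF PROPOSITION 5 AT `k` LEVELS, ON THE `P`-PERIODIC CONFIGURATIONS** — `B8Prop5GaugeParamKLevel.gaugeParam_kLevel`
VERBATIM with the `H_c`-hypotheses at periodic `λ` only, `H_c`, `G′` periodic-valued; conclusions as there PLUS `λ_s`, `λ_{s′}` periodic.
[cite: Balaban1985RegularSpaces, Prop. 5 (1.107)–(1.108) p.94, (1.100)–(1.103) p.93, (1.113)–(1.120) pp.95–96] -/
theorem gaugeParam_kLevel_per (hL : 1 ≤ L) (hη : 0 < η) (hU₀ : ∀ x κ, U₀ x κ ∈ unitaryUnits 𝔸) (P : ℤ)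
    (hEbΩ : ∀ j, j ≤ k → ∀ x ∈ Ω j, ∀ μ : Fin d, (x, μ) ∈ Eb j ∧ (x - e μ, μ) ∈ Eb j)
    (Gp R Hc : (Site d → 𝔸) → (Site d → 𝔸))
    {α₄ BG BR h₀ h₁ h₂ l₀ l₁ l₂ cA cDA : ℝ}
    (hα₄ : 0 ≤ α₄) (hBG : 0 ≤ BG) (hBR : 0 ≤ BR) (hh₀ : 0 ≤ h₀) (hh₂ : 0 ≤ h₂) (hl₀ : 0 ≤ l₀) (hl₁ : 0 ≤ l₁)
    (hl₂ : 0 ≤ l₂) (hcA : 0 ≤ cA) (hcA' : cA ≤ 1 / 13) (hcDA : 0 ≤ cDA)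
    (ha₁' : α₄ / 4 + h₀ ≤ 1 / 24) (hb₁' : α₄ / 4 + h₁ ≤ 1 / 140) (hb₁ : 0 < α₄ / 4 + h₁) (hθ : 10 * (α₄ / 4 + h₀) * BR ≤ 1 / 2)
    (hh₀' : h₀ ≤ 3 * α₄ / 4) (hh₁' : h₁ ≤ 3 * α₄ / 4)
    -- letters
    (hG : ∀ (f : Site d → 𝔸) (m : ℝ), 0 ≤ m → Bd2 L η k Ω f m →
      (∀ x, ‖Gp f x‖ ≤ BG * m) ∧ ∀ j, j ≤ k → ∀ p ∈ Eb j, wt L η j * ‖covDerivFwd η U₀ p.2 (Gp f) p.1‖ ≤ BG * m)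
    (hGsub : ∀ f g : Site d → 𝔸, Gp (f - g) = Gp f - Gp g)
    (hGper : ∀ (f : Site d → 𝔸) (z : Site d) (i : Fin d), Gp f (z + P • e i) = Gp f z)
    (hGsupp : ∀ (f : Site d → 𝔸) (x : Site d), x ∉ Ω 0 → Gp f x = 0)
    (hGreal : ∀ f : Site d → 𝔸, (∀ j, j ≤ k → ∀ x ∈ Ω j, IsSelfAdjoint (f x)) → ∀ x, IsSelfAdjoint (Gp f x))
    (hRsub : ∀ f g : Site d → 𝔸, R (f - g) = R f - R g)
    (hRbd : ∀ (f : Site d → 𝔸) (m : ℝ), 0 ≤ m → Bd2 L η k Ω f m → Bd2 L η k Ω (R f) (BR * m))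
    (hRreal : ∀ f : Site d → 𝔸, (∀ j, j ≤ k → ∀ x ∈ Ω j, IsSelfAdjoint (f x)) → ∀ j, j ≤ k → ∀ x ∈ Ω j, IsSelfAdjoint (R f x))
    -- the Sect. E correction `H_c` (λ′ = λ + H_c λ)
    (hc0 : ∀ s : lamSubK η U₀ L k Eb, (∀ (z : Site d) (i : Fin d), lamOf s (z + P • e i) = lamOf s z) → ‖s‖ ≤ α₄ / 4 →
      ∀ x, ‖Hc (lamOf s) x‖ ≤ h₀)
    (hc1 : ∀ s : lamSubK η U₀ L k Eb, (∀ (z : Site d) (i : Fin d), lamOf s (z + P • e i) = lamOf s z) → ‖s‖ ≤ α₄ / 4 →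
      ∀ j, j ≤ k → ∀ p ∈ Eb j, wt L η j * ‖covDerivFwd η U₀ p.2 (Hc (lamOf s)) p.1‖ ≤ h₁)
    (hc2 : ∀ s : lamSubK η U₀ L k Eb, (∀ (z : Site d) (i : Fin d), lamOf s (z + P • e i) = lamOf s z) → ‖s‖ ≤ α₄ / 4 →
      Bd2 L η k Ω (covLap η U₀ (Hc (lamOf s))) h₂)
    (hcL0 : ∀ s t : lamSubK η U₀ L k Eb, (∀ (z : Site d) (i : Fin d), lamOf s (z + P • e i) = lamOf s z) → (∀ (z : Site d) (i : Fin d), lamOf t (z + P • e i) = lamOf t z) →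
      ‖s‖ ≤ α₄ / 4 → ‖t‖ ≤ α₄ / 4 → ∀ x, ‖Hc (lamOf s) x - Hc (lamOf t) x‖ ≤ l₀ * ‖s - t‖)
    (hcL1 : ∀ s t : lamSubK η U₀ L k Eb, (∀ (z : Site d) (i : Fin d), lamOf s (z + P • e i) = lamOf s z) → (∀ (z : Site d) (i : Fin d), lamOf t (z + P • e i) = lamOf t z) →
      ‖s‖ ≤ α₄ / 4 → ‖t‖ ≤ α₄ / 4 → ∀ j, j ≤ k → ∀ p ∈ Eb j,
      wt L η j * ‖covDerivFwd η U₀ p.2 (Hc (lamOf s) - Hc (lamOf t)) p.1‖ ≤ l₁ * ‖s - t‖)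
    (hcL2 : ∀ s t : lamSubK η U₀ L k Eb, (∀ (z : Site d) (i : Fin d), lamOf s (z + P • e i) = lamOf s z) → (∀ (z : Site d) (i : Fin d), lamOf t (z + P • e i) = lamOf t z) →
      ‖s‖ ≤ α₄ / 4 → ‖t‖ ≤ α₄ / 4 → Bd2 L η k Ω (covLap η U₀ (Hc (lamOf s)) - covLap η U₀ (Hc (lamOf t))) (l₂ * ‖s - t‖))
    (hcsa : ∀ s : lamSubK η U₀ L k Eb, (∀ (z : Site d) (i : Fin d), lamOf s (z + P • e i) = lamOf s z) → ‖s‖ ≤ α₄ / 4 →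
      (∀ x, IsSelfAdjoint (lamOf s x)) → ∀ x, IsSelfAdjoint (Hc (lamOf s) x))
    (hcsupp : ∀ s : lamSubK η U₀ L k Eb, (∀ (z : Site d) (i : Fin d), lamOf s (z + P • e i) = lamOf s z) → ‖s‖ ≤ α₄ / 4 →
      ∀ x, x ∉ Ω 0 → Hc (lamOf s) x = 0)
    (hcper : ∀ s : lamSubK η U₀ L k Eb, (∀ (z : Site d) (i : Fin d), lamOf s (z + P • e i) = lamOf s z) → ‖s‖ ≤ α₄ / 4 →
      ∀ (z : Site d) (i : Fin d), Hc (lamOf s) (z + P • e i) = Hc (lamOf s) z)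
    -- the datum
    (hDA : Bd2 L η k Ω DA cDA) (hDAsa : ∀ j, j ≤ k → ∀ x ∈ Ω j, IsSelfAdjoint (DA x))
    (hA : ∀ j, j ≤ k → ∀ x ∈ Ω j, ∀ μ : Fin d,
      wt L η j * ‖A x μ‖ ≤ cA ∧ wt L η j * ‖conjR (U₀ (x - e μ) μ)⁻¹ (A (x - e μ) μ)‖ ≤ cA)
    (hAsa : ∀ x μ, IsSelfAdjoint (A x μ))
    -- smallness (1.103)/(1.106) on the explicit constants of the contraction
    (h103 : BG * Mc d BR (α₄ / 4 + h₁) cA h₂ cDA ≤ α₄ / 4)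
    (h106 : BG * Kc d BR (α₄ / 4 + h₁) cA h₂ cDA l₂ (1 + l₀) (1 + l₁) ≤ 1 / 2) :
    ∃ s s' : lamSubK η U₀ L k Eb,
      (∀ (z : Site d) (i : Fin d), lamOf s (z + P • e i) = lamOf s z) ∧ (∀ (z : Site d) (i : Fin d), lamOf s' (z + P • e i) = lamOf s' z) ∧
      ‖s‖ ≤ α₄ / 4 ∧
      lamOf s = Gp (PsiP5 η U₀ A DA R (fun lam => lam + Hc lam) (fun lam => covLap η U₀ (Hc lam)) (lamOf s)) ∧
      lamOf s' = lamOf s + Hc (lamOf s) ∧ ‖s'‖ ≤ α₄ ∧ (∀ x, IsSelfAdjoint (lamOf s' x)) ∧ (∀ x, x ∉ Ω 0 → lamOf s' x = 0) ∧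
      (∀ j, j ≤ k → ∀ x ∈ Ω j,
        Zsol (Wsrc η U₀ A DA (lamOf s') (covLap η U₀ (Hc (lamOf s)))) (Vop (lamOf s')) R x +
          Vop (lamOf s') (R (Zsol (Wsrc η U₀ A DA (lamOf s') (covLap η U₀ (Hc (lamOf s)))) (Vop (lamOf s')) R)) x =
        Wsrc η U₀ A DA (lamOf s') (covLap η U₀ (Hc (lamOf s))) x) := by
  set gpar : (Site d → 𝔸) → (Site d → 𝔸) := fun lam => lam + Hc lam with hgpar
  set Eterm : (Site d → 𝔸) → (Site d → 𝔸) := fun lam => covLap η U₀ (Hc lam) with hEterm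
  -- the displayed hypotheses of the contraction at (gpar, Eterm)
  have hg0 : ∀ s : lamSubK η U₀ L k Eb, (∀ (z : Site d) (i : Fin d), lamOf s (z + P • e i) = lamOf s z) → ‖s‖ ≤ α₄ / 4 →
      ∀ j, j ≤ k → ∀ x ∈ Ω j, ‖gpar (lamOf s) x‖ ≤ α₄ / 4 + h₀ :=
    fun s hp hs j _ x _ => gpar_size_at s hs (hc0 s hp hs) x
  have hg1 : ∀ s : lamSubK η U₀ L k Eb, (∀ (z : Site d) (i : Fin d), lamOf s (z + P • e i) = lamOf s z) → ‖s‖ ≤ α₄ / 4 → ∀ j, j ≤ k → ∀ x ∈ Ω j, ∀ μ : Fin d,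
      wt L η j * ‖covDerivFwd η U₀ μ (gpar (lamOf s)) x‖ ≤ α₄ / 4 + h₁ ∧ wt L η j * ‖covDeriv η U₀ μ (gpar (lamOf s)) x‖ ≤ α₄ / 4 + h₁ :=
    fun s hp hs j hj x hx μ => gpar_grad_at hη hU₀ hEbΩ s hs (hc1 s hp hs) hj hx μ
  have hgL : ∀ s t : lamSubK η U₀ L k Eb, (∀ (z : Site d) (i : Fin d), lamOf s (z + P • e i) = lamOf s z) → (∀ (z : Site d) (i : Fin d), lamOf t (z + P • e i) = lamOf t z) →
      ‖s‖ ≤ α₄ / 4 → ‖t‖ ≤ α₄ / 4 → ∀ j, j ≤ k → ∀ x ∈ Ω j,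
      ‖gpar (lamOf s) x - gpar (lamOf t) x‖ ≤ (1 + l₀) * ‖s - t‖ ∧ ∀ μ : Fin d,
        wt L η j * ‖covDerivFwd η U₀ μ (gpar (lamOf s) - gpar (lamOf t)) x‖ ≤ (1 + l₁) * ‖s - t‖ ∧
        wt L η j * ‖covDeriv η U₀ μ (gpar (lamOf s) - gpar (lamOf t)) x‖ ≤ (1 + l₁) * ‖s - t‖ :=
    fun s t hps hpt hs ht j hj x hx => gpar_lip_at hη hU₀ hEbΩ s t (hcL0 s t hps hpt hs ht) (hcL1 s t hps hpt hs ht) hj hx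
  have hE0 : ∀ s : lamSubK η U₀ L k Eb, (∀ (z : Site d) (i : Fin d), lamOf s (z + P • e i) = lamOf s z) → ‖s‖ ≤ α₄ / 4 → Bd2 L η k Ω (Eterm (lamOf s)) h₂ :=
    fun s hp hs => hc2 s hp hs
  have hEL : ∀ s t : lamSubK η U₀ L k Eb, (∀ (z : Site d) (i : Fin d), lamOf s (z + P • e i) = lamOf s z) → (∀ (z : Site d) (i : Fin d), lamOf t (z + P • e i) = lamOf t z) →
      ‖s‖ ≤ α₄ / 4 → ‖t‖ ≤ α₄ / 4 → Bd2 L η k Ω (Eterm (lamOf s) - Eterm (lamOf t)) (l₂ * ‖s - t‖) :=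
    fun s t hps hpt hs ht => hcL2 s t hps hpt hs ht
  -- the fixed point (on the periodic configurations)
  obtain ⟨s, hp, hs, hfix, -⟩ := propFive_fixedPoint_kLevel_per (Ω := Ω) (Eb := Eb) (U₀ := U₀) (A := A) (DA := DA) hL hη P Gp R gpar Eterm
    hα₄ hBG hBR (by positivity) ha₁' hb₁ hb₁' hcA hcA' hcDA hh₂ hl₂ (by positivity) (by positivity) hθ hG hGsub hGper hRsub hRbd hg0 hg1 hgL
    hE0 hEL hDA hA h103 h106
  obtain ⟨hN, -, -, hoff⟩ := propFive_fixedPoint_kLevel_spec_per (Ω := Ω) (Eb := Eb) (U₀ := U₀) (A := A) (DA := DA) hL hη P Gp R gpar Eterm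
    hBR (by positivity) ha₁' hb₁ hb₁' hcA hcA' hcDA hh₂ hθ hG hGsupp hRsub hRbd hg0 hg1 hE0 hDA hA hp hs hfix
  -- reality
  have hgsa : ∀ t : lamSubK η U₀ L k Eb, (∀ (z : Site d) (i : Fin d), lamOf t (z + P • e i) = lamOf t z) → ‖t‖ ≤ α₄ / 4 →
      (∀ x, IsSelfAdjoint (lamOf t x)) → ∀ x, IsSelfAdjoint (gpar (lamOf t) x) :=
    fun t hpt ht hsa x => (hsa x).add (hcsa t hpt ht hsa x)
  have hEsa : ∀ t : lamSubK η U₀ L k Eb, (∀ (z : Site d) (i : Fin d), lamOf t (z + P • e i) = lamOf t z) → ‖t‖ ≤ α₄ / 4 →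
      (∀ x, IsSelfAdjoint (lamOf t x)) → ∀ j, j ≤ k → ∀ x ∈ Ω j, IsSelfAdjoint (Eterm (lamOf t) x) :=
    fun t hpt ht hsa j _ x _ => isSelfAdjoint_covLap hU₀ (hcsa t hpt ht hsa) x
  have hsa : ∀ x, IsSelfAdjoint (lamOf s x) :=
    propFive_fixedPoint_kLevel_selfAdjoint_per (Ω := Ω) (Eb := Eb) (U₀ := U₀) (A := A) (DA := DA) hL hη hU₀ P Gp R gpar Eterm hα₄ hBG hBR
      (by positivity) ha₁' hb₁ hb₁' hcA hcA' hcDA hh₂ hl₂ (by positivity) (by positivity) hθ hG hGsub hGper hRsub hRbd hg0 hg1 hgL hE0 hEL hDA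
      hA h103 h106 hAsa hDAsa hgsa hEsa hRreal hGreal hp hs hfix
  -- the gauge parameter as a point of the λ-space
  have hb_lam : ∀ x, ‖gpar (lamOf s) x‖ ≤ α₄ := fun x => by
    have := gpar_size_at s hs (hc0 s hp hs) x; simp only [hgpar] at this ⊢; linarith
  have hb_grad : ∀ j, j ≤ k → ∀ p ∈ Eb j, wt L η j * ‖covDerivFwd η U₀ p.2 (gpar (lamOf s)) p.1‖ ≤ α₄ := by
    intro j hj p hp'
    have hw : 0 ≤ wt L η j := wt_nonneg L hη.le j
    simp only [hgpar]
    rw [covDerivFwd_add']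
    calc wt L η j * ‖covDerivFwd η U₀ p.2 (lamOf s) p.1 + covDerivFwd η U₀ p.2 (Hc (lamOf s)) p.1‖
        ≤ wt L η j * (‖covDerivFwd η U₀ p.2 (lamOf s) p.1‖ + ‖covDerivFwd η U₀ p.2 (Hc (lamOf s)) p.1‖) :=
          mul_le_mul_of_nonneg_left (norm_add_le _ _) hw
      _ ≤ α₄ / 4 + h₁ := by rw [mul_add]; exact add_le_add ((weight_mul_norm_covDerivFwd_le hη.le s hj hp').trans hs) (hc1 s hp hs j hj p hp')
      _ ≤ α₄ := by linarith
  set s' : lamSubK η U₀ L k Eb := mkLam hη.le (gpar (lamOf s)) hb_lam hb_grad with hs'def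
  have hs'lam : lamOf s' = gpar (lamOf s) := lamOf_mkLam hη.le _ hb_lam hb_grad
  refine ⟨s, s', hp, ?_, hs, hfix, hs'lam, ?_, ?_, ?_, ?_⟩
  · intro z i
    rw [hs'lam]; simp only [hgpar, Pi.add_apply]
    rw [hp z i, hcper s hp hs z i]
  · exact (norm_mkLam_le hη.le _ hb_lam hb_grad).trans (max_le le_rfl le_rfl)
  · intro x; rw [hs'lam]; exact hgsa s hp hs hsa x
  · intro x hx
    rw [hs'lam]; simp only [hgpar, Pi.add_apply]
    rw [hoff x hx, hcsupp s hp hs x hx, add_zero]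
  · intro j hj x hx
    rw [hs'lam]
    exact hN j hj x hx


/-- ★ **… AND `τ`-FREE** — `B8Prop5GaugeParamTraceFree.gaugeParam_kLevel_traceFree` VERBATIM with the `H_c`-hypotheses (incl. `hcτ`) at periodic
`λ` only, `H_c`, `G′` periodic-valued. [cite: Balaban1985RegularSpaces, Prop. 5 (1.107)–(1.108) p.94, (1.100)–(1.103) p.93, (1.17) p.78, (1.113)–(1.120) pp.95–96] -/
theorem gaugeParam_kLevel_traceFree_per (hτ : ∀ x y : 𝔸, τ (x * y) = τ (y * x))
    (hlog : ∀ a b : 𝔸, ‖a‖ + ‖b‖ ≤ 1 / 2 → τ (mlog (exp a * exp b)) = τ a + τ b)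
    (hL : 1 ≤ L) (hη : 0 < η) (hU₀ : ∀ x κ, U₀ x κ ∈ unitaryUnits 𝔸) (P : ℤ)
    (hEbΩ : ∀ j, j ≤ k → ∀ x ∈ Ω j, ∀ μ : Fin d, (x, μ) ∈ Eb j ∧ (x - e μ, μ) ∈ Eb j)
    (Gp R Hc : (Site d → 𝔸) → (Site d → 𝔸))
    {α₄ BG BR h₀ h₁ h₂ l₀ l₁ l₂ cA cDA : ℝ}
    (hα₄ : 0 ≤ α₄) (hBG : 0 ≤ BG) (hBR : 0 ≤ BR) (hh₀ : 0 ≤ h₀) (hh₂ : 0 ≤ h₂) (hl₀ : 0 ≤ l₀) (hl₁ : 0 ≤ l₁)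
    (hl₂ : 0 ≤ l₂) (hcA : 0 ≤ cA) (hcA' : cA ≤ 1 / 13) (hcDA : 0 ≤ cDA)
    (ha₁' : α₄ / 4 + h₀ ≤ 1 / 24) (hb₁' : α₄ / 4 + h₁ ≤ 1 / 140) (hb₁ : 0 < α₄ / 4 + h₁) (hθ : 10 * (α₄ / 4 + h₀) * BR ≤ 1 / 2)
    (hh₀' : h₀ ≤ 3 * α₄ / 4) (hh₁' : h₁ ≤ 3 * α₄ / 4)
    -- letters
    (hG : ∀ (f : Site d → 𝔸) (m : ℝ), 0 ≤ m → Bd2 L η k Ω f m →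
      (∀ x, ‖Gp f x‖ ≤ BG * m) ∧ ∀ j, j ≤ k → ∀ p ∈ Eb j, wt L η j * ‖covDerivFwd η U₀ p.2 (Gp f) p.1‖ ≤ BG * m)
    (hGsub : ∀ f g : Site d → 𝔸, Gp (f - g) = Gp f - Gp g)
    (hGper : ∀ (f : Site d → 𝔸) (z : Site d) (i : Fin d), Gp f (z + P • e i) = Gp f z)
    (hGsupp : ∀ (f : Site d → 𝔸) (x : Site d), x ∉ Ω 0 → Gp f x = 0)
    (hGreal : ∀ f : Site d → 𝔸, (∀ j, j ≤ k → ∀ x ∈ Ω j, IsSelfAdjoint (f x)) → ∀ x, IsSelfAdjoint (Gp f x))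
    (hRsub : ∀ f g : Site d → 𝔸, R (f - g) = R f - R g)
    (hRbd : ∀ (f : Site d → 𝔸) (m : ℝ), 0 ≤ m → Bd2 L η k Ω f m → Bd2 L η k Ω (R f) (BR * m))
    (hRreal : ∀ f : Site d → 𝔸, (∀ j, j ≤ k → ∀ x ∈ Ω j, IsSelfAdjoint (f x)) → ∀ j, j ≤ k → ∀ x ∈ Ω j, IsSelfAdjoint (R f x))
    -- the Sect. E correction `H_c` (λ′ = λ + H_c λ)
    (hc0 : ∀ s : lamSubK η U₀ L k Eb, (∀ (z : Site d) (i : Fin d), lamOf s (z + P • e i) = lamOf s z) → ‖s‖ ≤ α₄ / 4 →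
      ∀ x, ‖Hc (lamOf s) x‖ ≤ h₀)
    (hc1 : ∀ s : lamSubK η U₀ L k Eb, (∀ (z : Site d) (i : Fin d), lamOf s (z + P • e i) = lamOf s z) → ‖s‖ ≤ α₄ / 4 →
      ∀ j, j ≤ k → ∀ p ∈ Eb j, wt L η j * ‖covDerivFwd η U₀ p.2 (Hc (lamOf s)) p.1‖ ≤ h₁)
    (hc2 : ∀ s : lamSubK η U₀ L k Eb, (∀ (z : Site d) (i : Fin d), lamOf s (z + P • e i) = lamOf s z) → ‖s‖ ≤ α₄ / 4 →
      Bd2 L η k Ω (covLap η U₀ (Hc (lamOf s))) h₂)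
    (hcL0 : ∀ s t : lamSubK η U₀ L k Eb, (∀ (z : Site d) (i : Fin d), lamOf s (z + P • e i) = lamOf s z) → (∀ (z : Site d) (i : Fin d), lamOf t (z + P • e i) = lamOf t z) →
      ‖s‖ ≤ α₄ / 4 → ‖t‖ ≤ α₄ / 4 → ∀ x, ‖Hc (lamOf s) x - Hc (lamOf t) x‖ ≤ l₀ * ‖s - t‖)
    (hcL1 : ∀ s t : lamSubK η U₀ L k Eb, (∀ (z : Site d) (i : Fin d), lamOf s (z + P • e i) = lamOf s z) → (∀ (z : Site d) (i : Fin d), lamOf t (z + P • e i) = lamOf t z) →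
      ‖s‖ ≤ α₄ / 4 → ‖t‖ ≤ α₄ / 4 → ∀ j, j ≤ k → ∀ p ∈ Eb j,
      wt L η j * ‖covDerivFwd η U₀ p.2 (Hc (lamOf s) - Hc (lamOf t)) p.1‖ ≤ l₁ * ‖s - t‖)
    (hcL2 : ∀ s t : lamSubK η U₀ L k Eb, (∀ (z : Site d) (i : Fin d), lamOf s (z + P • e i) = lamOf s z) → (∀ (z : Site d) (i : Fin d), lamOf t (z + P • e i) = lamOf t z) →
      ‖s‖ ≤ α₄ / 4 → ‖t‖ ≤ α₄ / 4 → Bd2 L η k Ω (covLap η U₀ (Hc (lamOf s)) - covLap η U₀ (Hc (lamOf t))) (l₂ * ‖s - t‖))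
    (hcsa : ∀ s : lamSubK η U₀ L k Eb, (∀ (z : Site d) (i : Fin d), lamOf s (z + P • e i) = lamOf s z) → ‖s‖ ≤ α₄ / 4 →
      (∀ x, IsSelfAdjoint (lamOf s x)) → ∀ x, IsSelfAdjoint (Hc (lamOf s) x))
    (hcsupp : ∀ s : lamSubK η U₀ L k Eb, (∀ (z : Site d) (i : Fin d), lamOf s (z + P • e i) = lamOf s z) → ‖s‖ ≤ α₄ / 4 →
      ∀ x, x ∉ Ω 0 → Hc (lamOf s) x = 0)
    (hcper : ∀ s : lamSubK η U₀ L k Eb, (∀ (z : Site d) (i : Fin d), lamOf s (z + P • e i) = lamOf s z) → ‖s‖ ≤ α₄ / 4 →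
      ∀ (z : Site d) (i : Fin d), Hc (lamOf s) (z + P • e i) = Hc (lamOf s) z)
    -- the datum
    (hDA : Bd2 L η k Ω DA cDA) (hDAsa : ∀ j, j ≤ k → ∀ x ∈ Ω j, IsSelfAdjoint (DA x))
    (hA : ∀ j, j ≤ k → ∀ x ∈ Ω j, ∀ μ : Fin d,
      wt L η j * ‖A x μ‖ ≤ cA ∧ wt L η j * ‖conjR (U₀ (x - e μ) μ)⁻¹ (A (x - e μ) μ)‖ ≤ cA)
    (hAsa : ∀ x μ, IsSelfAdjoint (A x μ))
    -- smallness (1.103)/(1.106) on the explicit constants of the contraction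
    (h103 : BG * Mc d BR (α₄ / 4 + h₁) cA h₂ cDA ≤ α₄ / 4)
    (h106 : BG * Kc d BR (α₄ / 4 + h₁) cA h₂ cDA l₂ (1 + l₀) (1 + l₁) ≤ 1 / 2)
    -- `τ`-freeness of the datum, the correction and the letters
    (hDAτ : ∀ j, j ≤ k → ∀ x ∈ Ω j, τ (DA x) = 0)
    (hcτ : ∀ s : lamSubK η U₀ L k Eb, (∀ (z : Site d) (i : Fin d), lamOf s (z + P • e i) = lamOf s z) → ‖s‖ ≤ α₄ / 4 →
      (∀ x, τ (lamOf s x) = 0) → ∀ x, τ (Hc (lamOf s) x) = 0)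
    (hRτ : ∀ f : Site d → 𝔸, (∀ j, j ≤ k → ∀ x ∈ Ω j, τ (f x) = 0) → ∀ j, j ≤ k → ∀ x ∈ Ω j, τ (R f x) = 0)
    (hGτ : ∀ f : Site d → 𝔸, (∀ j, j ≤ k → ∀ x ∈ Ω j, τ (f x) = 0) → ∀ x, τ (Gp f x) = 0) :
    ∃ s s' : lamSubK η U₀ L k Eb,
      (∀ (z : Site d) (i : Fin d), lamOf s (z + P • e i) = lamOf s z) ∧ (∀ (z : Site d) (i : Fin d), lamOf s' (z + P • e i) = lamOf s' z) ∧
      ‖s‖ ≤ α₄ / 4 ∧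
      lamOf s = Gp (PsiP5 η U₀ A DA R (fun lam => lam + Hc lam) (fun lam => covLap η U₀ (Hc lam)) (lamOf s)) ∧
      lamOf s' = lamOf s + Hc (lamOf s) ∧ ‖s'‖ ≤ α₄ ∧ (∀ x, IsSelfAdjoint (lamOf s' x)) ∧ (∀ x, x ∉ Ω 0 → lamOf s' x = 0) ∧
      (∀ j, j ≤ k → ∀ x ∈ Ω j,
        Zsol (Wsrc η U₀ A DA (lamOf s') (covLap η U₀ (Hc (lamOf s)))) (Vop (lamOf s')) R x +
          Vop (lamOf s') (R (Zsol (Wsrc η U₀ A DA (lamOf s') (covLap η U₀ (Hc (lamOf s)))) (Vop (lamOf s')) R)) x =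
        Wsrc η U₀ A DA (lamOf s') (covLap η U₀ (Hc (lamOf s))) x) ∧
      (∀ x, τ (lamOf s' x) = 0) := by
  obtain ⟨s, s', hp, hp', hs, hfix, hs', hn', hsa', hoff', hN⟩ := gaugeParam_kLevel_per (Ω := Ω) (Eb := Eb) (U₀ := U₀) (A := A) (DA := DA)
    hL hη hU₀ P hEbΩ Gp R Hc hα₄ hBG hBR hh₀ hh₂ hl₀ hl₁ hl₂ hcA hcA' hcDA ha₁' hb₁' hb₁ hθ hh₀' hh₁' hG hGsub hGper hGsupp hGreal hRsub hRbd
    hRreal hc0 hc1 hc2 hcL0 hcL1 hcL2 hcsa hcsupp hcper hDA hDAsa hA hAsa h103 h106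
  refine ⟨s, s', hp, hp', hs, hfix, hs', hn', hsa', hoff', hN, ?_⟩
  -- the displayed hypotheses of the contraction at `gpar λ = λ + H_c λ`, `Eterm λ = ΔH_c λ`
  set gpar : (Site d → 𝔸) → (Site d → 𝔸) := fun lam => lam + Hc lam with hgpar
  set Eterm : (Site d → 𝔸) → (Site d → 𝔸) := fun lam => covLap η U₀ (Hc lam) with hEterm
  have hg0 : ∀ s : lamSubK η U₀ L k Eb, (∀ (z : Site d) (i : Fin d), lamOf s (z + P • e i) = lamOf s z) → ‖s‖ ≤ α₄ / 4 →
      ∀ j, j ≤ k → ∀ x ∈ Ω j, ‖gpar (lamOf s) x‖ ≤ α₄ / 4 + h₀ :=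
    fun s hp hs j _ x _ => gpar_size_at s hs (hc0 s hp hs) x
  have hg1 : ∀ s : lamSubK η U₀ L k Eb, (∀ (z : Site d) (i : Fin d), lamOf s (z + P • e i) = lamOf s z) → ‖s‖ ≤ α₄ / 4 → ∀ j, j ≤ k → ∀ x ∈ Ω j, ∀ μ : Fin d,
      wt L η j * ‖covDerivFwd η U₀ μ (gpar (lamOf s)) x‖ ≤ α₄ / 4 + h₁ ∧ wt L η j * ‖covDeriv η U₀ μ (gpar (lamOf s)) x‖ ≤ α₄ / 4 + h₁ :=
    fun s hp hs j hj x hx μ => gpar_grad_at hη hU₀ hEbΩ s hs (hc1 s hp hs) hj hx μ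
  have hgL : ∀ s t : lamSubK η U₀ L k Eb, (∀ (z : Site d) (i : Fin d), lamOf s (z + P • e i) = lamOf s z) → (∀ (z : Site d) (i : Fin d), lamOf t (z + P • e i) = lamOf t z) →
      ‖s‖ ≤ α₄ / 4 → ‖t‖ ≤ α₄ / 4 → ∀ j, j ≤ k → ∀ x ∈ Ω j,
      ‖gpar (lamOf s) x - gpar (lamOf t) x‖ ≤ (1 + l₀) * ‖s - t‖ ∧ ∀ μ : Fin d,
        wt L η j * ‖covDerivFwd η U₀ μ (gpar (lamOf s) - gpar (lamOf t)) x‖ ≤ (1 + l₁) * ‖s - t‖ ∧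
        wt L η j * ‖covDeriv η U₀ μ (gpar (lamOf s) - gpar (lamOf t)) x‖ ≤ (1 + l₁) * ‖s - t‖ :=
    fun s t hps hpt hs ht j hj x hx => gpar_lip_at hη hU₀ hEbΩ s t (hcL0 s t hps hpt hs ht) (hcL1 s t hps hpt hs ht) hj hx
  have hE0 : ∀ s : lamSubK η U₀ L k Eb, (∀ (z : Site d) (i : Fin d), lamOf s (z + P • e i) = lamOf s z) → ‖s‖ ≤ α₄ / 4 → Bd2 L η k Ω (Eterm (lamOf s)) h₂ :=
    fun s hp hs => hc2 s hp hs
  have hEL : ∀ s t : lamSubK η U₀ L k Eb, (∀ (z : Site d) (i : Fin d), lamOf s (z + P • e i) = lamOf s z) → (∀ (z : Site d) (i : Fin d), lamOf t (z + P • e i) = lamOf t z) →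
      ‖s‖ ≤ α₄ / 4 → ‖t‖ ≤ α₄ / 4 → Bd2 L η k Ω (Eterm (lamOf s) - Eterm (lamOf t)) (l₂ * ‖s - t‖) :=
    fun s t hps hpt hs ht => hcL2 s t hps hpt hs ht
  have hEτ : ∀ t : lamSubK η U₀ L k Eb, (∀ (z : Site d) (i : Fin d), lamOf t (z + P • e i) = lamOf t z) → ‖t‖ ≤ α₄ / 4 → (∀ x, τ (lamOf t x) = 0) →
      ∀ j, j ≤ k → ∀ x ∈ Ω j, τ (Eterm (lamOf t) x) = 0 := fun t hpt ht htf j _ x _ => apply_covLap τ hτ U₀ (hcτ t hpt ht htf) x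
  -- layer 1: the periodic fixed point is `τ`-free
  have hsτ : ∀ x, τ (lamOf s x) = 0 :=
    propFive_fixedPoint_kLevel_traceFree_per (Ω := Ω) (Eb := Eb) (U₀ := U₀) (A := A) (DA := DA) τ hτ hlog hL hη P Gp R gpar Eterm hα₄ hBG
      hBR (by positivity) ha₁' hb₁ hb₁' hcA hcA' hcDA hh₂ hl₂ (by positivity) (by positivity) hθ hG hGsub hGper hRsub hRbd hg0 hg1 hgL hE0 hEL
      hDA hA h103 h106 hDAτ hEτ hRτ hGτ hp hs hfix
  intro x
  rw [hs', Pi.add_apply, map_add, hsτ x, hcτ s hp hs hsτ x, add_zero]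


end GaugeParam

#print axioms gaugeParam_kLevel_per
#print axioms gaugeParam_kLevel_traceFree_per

end Literature.MathematicalPhysics.QuantumFieldTheory.Balaban1983to89.B8Prop5GaugeParamKLevelPer

end
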